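import Summits.Ventures.QEC.Thresholds.PlanarSurfaceCodePhenomSAWThresholds
import Summits.Ventures.QEC.Thresholds.PhenomenologicalThresholdConverses
import HarnessLib

/-!
# Certified INTERVALS of record for the PLANAR surface codes at the memory-16 / cubic memory-12 kernel certificates:
# `.0357 < p_c ≤ 1/4` (both sectors), `.0535 < p_c^{depol} ≤ 3/8`, `.0112 < p_c^{ph} ≤ 1/4` (both records)
# — min-weight AND boundary-MWPM decoder families — UNCONDITIONAL, kernel

Venture QEC, `Summits/Ventures/QEC/Thresholds/` (LADDER-QEC rung Q5 «certified interval floor ≤ p_c ≤ ceiling»; qec-type-09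
gen 6, the planar twin of `ToricCodeIntervalsKernelSymm.lean`). qec-lit-2's interval files (`PlanarThresholdConverses.lean`,
`PhenomenologicalThresholdConverses.lean`) pair the cluster-expansion floors `p₀(3)`, `p₀(5)` with the ceilings `1/4` / `3/8`
(erasure decomposition + the coordinate-swap self-duality of the planar code). This file re-pairs the SAME ceilings with the
kernel-certificate floors of item 135 (`PlanarSurfaceCodeSAWThresholds{,Dual}.lean`: `μ(ℤ²) ≤ 2.6939`;
`PlanarSurfaceCodePhenomSAWThresholds.lean`: `μ(ℤ³) ≤ 4.7476`):

| noise / decoder class | interval | decoders |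
|---|---|---|
| code capacity, `H_X` sector | **`.0357 < p_c ≤ 1/4`** | every min-weight family (`planar_capacity_accuracyThreshold_mem_0357`), every boundary-MWPM family (`planar_mwpm_capacity_accuracyThreshold_mem_0357`); ceiling for every decoder |
| code capacity, `H_Z` sector | **`.0357 < p_c ≤ 1/4`** | min-weight (`planar_capacity_accuracyThreshold_mem_0357'`), boundary MWPM (`planar_mwpm_capacity_accuracyThreshold_mem_0357'`) |
| depolarizing, sector-wise | **`.0535 < p_c^{depol} ≤ 3/8`** | min-weight pairs (`planar_depolarizing_accuracyThreshold_mem_0535`); ceiling for every pair |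
| phenomenological `q = p`, `H_X` record | **`.0112 < p_c^{ph} ≤ 1/4`** | min-weight space-time (`planar_phenom_accuracyThreshold_mem_0112`), space-time boundary MWPM (`planar_phenom_mwpm_accuracyThreshold_mem_0112`); poly rounds `T_k ≥ 1`; ceiling for every space-time decoder |
| phenomenological `q = p`, `H_Z` record | **`.0112 < p_c^{ph} ≤ 1/4`** | min-weight space-time (`planar_phenom_accuracyThreshold_mem_0112'`), boundary MWPM (`planar_phenom_mwpm_accuracyThreshold_mem_0112'`) |

Loss: `y_c = 1/2` EXACTLY in both sectors is qec-type-03's `PlanarLossThresholdHalf.lean` (`planar_erasure_accuracyThreshold_eq_half`),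
not restated. HONEST FRAMING: every floor is a certified LOWER bound strictly below the printed estimates (optimal `≈ .109`,
MWPM `≈ .103`, phenomenological `≈ .029`), which remain VALIDATED values, NOT theorems; the ceilings hold for EVERY decoder.
Kernel axioms only; no named fact; no `native_decide`; theorem-only file.

## References

* [DennisEtAl2002] E. Dennis, A. Kitaev, A. Landahl, J. Preskill, J. Math. Phys. 43 (2002) 4452, §4.1, §4.6, §5.1, §5.3
  (eqs. (p_c_2d), (threshold_iso_num)).
* [RichardsonUrbanke2008] T. Richardson, R. Urbanke, *Modern Coding Theory*, CUP 2008, Lemma 4.78 (Erasure Decomposition).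
* [StaceBarrettDoherty2009] T. M. Stace, S. D. Barrett, A. C. Doherty, PRL 102 (2009) 200501, p. 2 (no-cloning bound).
* [WangHarringtonPreskill2003] C. Wang, J. Harrington, J. Preskill, Ann. Phys. 303 (2003) 31–58, abstract (`.1031`, `.0293`).
-/

noncomputable section

namespace Summit.Ventures.QEC.Thresholds

open Filter Topology Finset Matrix
open Literature.InformationTheory.QuantumCodes
open Literature.InformationTheory.QuantumCodes.ToricCode (IsPolyBounded)
open Literature.Probability.RandomPlanarGeometry

/-! ### Code capacity -/

/-- **`.0357 < p_c ≤ 1/4`** (perfect measurement, `H_X` sector): floor for every minimum-weight decoder family, ceiling for every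
decoder family. [cite: DennisEtAl2002, §5.3 eq. (p_c_2d) and §4.6] [cite: RichardsonUrbanke2008, Lemma 4.78] -/
theorem planar_capacity_accuracyThreshold_mem_0357 (D : ∀ k, Decoder (PlanarCheck k → ZMod 2) (PlanarQubit k → ZMod 2))
    (hD : ∀ k, (D k).IsMinWeight (fun e => planarHX k *ᵥ e) {x | planarHX k *ᵥ x = 0} hammingNorm) :
    (0.0357 : ℝ) < accuracyThreshold (planarFailureFamily D) ∧ accuracyThreshold (planarFailureFamily D) ≤ 1 / 4 :=
  ⟨planar_accuracyThreshold_gt_0357 D hD, planar_z_capacity_accuracyThreshold_le_quarter D⟩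

/-- **`.0357 < p_c^{MWPM} ≤ 1/4`** (`H_X` sector, every boundary-MWPM family: graphlike presentation, link metric, matching).
[cite: DennisEtAl2002, §5.1 and §5.3 eq. (p_c_2d), §4.6] -/
theorem planar_mwpm_capacity_accuracyThreshold_mem_0357 {ι : ∀ k, PlanarQubit k → Sym2 (Option (PlanarCheck k))}
    (hι : ∀ k, IsGraphlikeVia (planarHX k) (ι k)) (m : ∀ k, EdgeMetric (ι k))
    {D' : ∀ k, Decoder (Option (PlanarCheck k) → ZMod 2) (PlanarQubit k → ZMod 2)}
    (hD : ∀ k, IsMatchingDecoder (m k) (D' k)) :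
    (0.0357 : ℝ) < accuracyThreshold (planarFailureFamily fun k => boundaryDecoder (D' k)) ∧
      accuracyThreshold (planarFailureFamily fun k => boundaryDecoder (D' k)) ≤ 1 / 4 :=
  ⟨planar_mwpm_accuracyThreshold_gt_0357 hι m hD, planar_z_capacity_accuracyThreshold_le_quarter _⟩

/-- **`.0357 < p_c ≤ 1/4`**, `H_Z` sector, every minimum-weight decoder family (ceiling for every decoder family).
[cite: DennisEtAl2002, §3.1, §5.3 eq. (p_c_2d) and §4.6] [cite: RichardsonUrbanke2008, Lemma 4.78] -/
theorem planar_capacity_accuracyThreshold_mem_0357' (D' : ∀ k, Decoder (PlanarZCheck k → ZMod 2) (PlanarQubit k → ZMod 2))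
    (hD' : ∀ k, (D' k).IsMinWeight (fun e => planarHZ k *ᵥ e) {x | planarHZ k *ᵥ x = 0} hammingNorm) :
    (0.0357 : ℝ) < accuracyThreshold (planarFailureFamily' D') ∧ accuracyThreshold (planarFailureFamily' D') ≤ 1 / 4 :=
  ⟨planar_accuracyThreshold'_gt_0357 D' hD', planar_x_capacity_accuracyThreshold_le_quarter D'⟩

/-- **`.0357 < p_c^{MWPM} ≤ 1/4`**, `H_Z` sector, every boundary-MWPM family. [cite: DennisEtAl2002, §5.1, §5.3 eq. (p_c_2d), §4.6] -/
theorem planar_mwpm_capacity_accuracyThreshold_mem_0357' {ι : ∀ k, PlanarQubit k → Sym2 (Option (PlanarZCheck k))}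
    (hι : ∀ k, IsGraphlikeVia (planarHZ k) (ι k)) (m : ∀ k, EdgeMetric (ι k))
    {D' : ∀ k, Decoder (Option (PlanarZCheck k) → ZMod 2) (PlanarQubit k → ZMod 2)}
    (hD : ∀ k, IsMatchingDecoder (m k) (D' k)) :
    (0.0357 : ℝ) < accuracyThreshold (planarFailureFamily' fun k => boundaryDecoder (D' k)) ∧
      accuracyThreshold (planarFailureFamily' fun k => boundaryDecoder (D' k)) ≤ 1 / 4 :=
  ⟨lt_of_lt_of_le thresholdValue_26939_bounds.1
      (le_accuracyThreshold (planar_mwpm_isThresholdLowerBound'_kernelSymmK16 hι m hD)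
        ((thresholdValue_le_half _).trans (by norm_num))),
    planar_x_capacity_accuracyThreshold_le_quarter _⟩

/-! ### Depolarizing noise, sector-wise decoding -/

/-- **`.0535 < p_c^{depol} ≤ 3/8`** (i.i.d. depolarizing noise, sector-wise minimum-weight decoding of the planar code; ceiling for
every pair of sector decoder families). [cite: DennisEtAl2002, §4.1 and §4.6] [cite: RichardsonUrbanke2008, Lemma 4.78] -/
theorem planar_depolarizing_accuracyThreshold_mem_0535
    (DX : ∀ k, Decoder (PlanarZCheck k → ZMod 2) (PlanarQubit k → ZMod 2))
    (DZ : ∀ k, Decoder (PlanarCheck k → ZMod 2) (PlanarQubit k → ZMod 2))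
    (hDX : ∀ k, (DX k).IsMinWeight (fun e => planarHZ k *ᵥ e) {x | planarHZ k *ᵥ x = 0} hammingNorm)
    (hDZ : ∀ k, (DZ k).IsMinWeight (fun e => planarHX k *ᵥ e) {x | planarHX k *ᵥ x = 0} hammingNorm) :
    (0.0535 : ℝ) < accuracyThreshold (depolarizingFailureFamily (fun k => planarHGPCode k) DX DZ) ∧
      accuracyThreshold (depolarizingFailureFamily (fun k => planarHGPCode k) DX DZ) ≤ 3 / 8 :=
  ⟨planar_depolarizing_accuracyThreshold_gt_0535 DX DZ hDX hDZ,
    depolarizingAccuracyThreshold_le_three_eighths (fun k => planarHGPCode k) planarHGPCode_k_pos DX DZ⟩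

/-! ### Phenomenological noise (`q = p`) -/

/-- **`.0112 < p_c^{ph} ≤ 1/4`** (noisy `H_X` record, every minimum-weight space-time decoder family, polynomially bounded rounds
`T_k ≥ 1`; ceiling for every space-time decoder family). [cite: DennisEtAl2002, §5.3 eq. (threshold_iso_num) and §4.6]
[cite: RichardsonUrbanke2008, Lemma 4.78] -/
theorem planar_phenom_accuracyThreshold_mem_0112 {T : ℕ → ℕ} (hT : IsPolyBounded T) (hT1 : ∀ k, 0 < T k)
    (D : ∀ k, CSSPhenom.STDecoder (PlanarCheck k) (PlanarQubit k) (T k))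
    (hD : ∀ k, (D k).IsMinWeight (CSSPhenom.stSyn (planarHX k) (T k)) (CSSPhenom.stCycles (planarHX k) (T k)) hammingNorm) :
    (0.0112 : ℝ) < accuracyThreshold (planarPhenomFailureFamily T D) ∧
      accuracyThreshold (planarPhenomFailureFamily T D) ≤ 1 / 4 :=
  ⟨planar_phenom_accuracyThreshold_gt_0112 hT D hD, planar_phenom_accuracyThreshold_le_quarter hT1 D⟩

/-- **`.0112 < p_c^{ph,MWPM} ≤ 1/4`** (noisy `H_X` record, every space-time boundary-MWPM family, poly rounds `T_k ≥ 1`).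
[cite: DennisEtAl2002, §5.1 p. 19, §5.3 eq. (threshold_iso_num), §4.6] -/
theorem planar_phenom_mwpm_accuracyThreshold_mem_0112 {T : ℕ → ℕ} (hT : IsPolyBounded T) (hT1 : ∀ k, 0 < T k)
    {ι : ∀ k, PlanarQubit k → Sym2 (Option (PlanarCheck k))} (hι : ∀ k, IsGraphlikeVia (planarHX k) (ι k))
    (m : ∀ k, EdgeMetric (stEndsOf (ι k) (T k)))
    {D' : ∀ k, Decoder (Option (PlanarCheck k × Fin (T k + 1)) → ZMod 2)
      (HistoryLoc (PlanarQubit k) (PlanarCheck k) (T k) → ZMod 2)}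
    (hD : ∀ k, IsMatchingDecoder (m k) (D' k)) :
    (0.0112 : ℝ) < accuracyThreshold (planarPhenomFailureFamily T fun k => boundaryDecoder (D' k)) ∧
      accuracyThreshold (planarPhenomFailureFamily T fun k => boundaryDecoder (D' k)) ≤ 1 / 4 :=
  ⟨planar_phenom_mwpm_accuracyThreshold_gt_0112 hT hι m hD, planar_phenom_accuracyThreshold_le_quarter hT1 _⟩

/-- **`.0112 < p_c^{ph} ≤ 1/4`**, noisy `H_Z` record, every minimum-weight space-time decoder family, poly rounds `T_k ≥ 1`.
[cite: DennisEtAl2002, §4.1, §5.3 eq. (threshold_iso_num) and §4.6] [cite: RichardsonUrbanke2008, Lemma 4.78] -/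
theorem planar_phenom_accuracyThreshold_mem_0112' {T : ℕ → ℕ} (hT : IsPolyBounded T) (hT1 : ∀ k, 0 < T k)
    (D' : ∀ k, CSSPhenom.STDecoder (PlanarZCheck k) (PlanarQubit k) (T k))
    (hD' : ∀ k, (D' k).IsMinWeight (CSSPhenom.stSyn (planarHZ k) (T k)) (CSSPhenom.stCycles (planarHZ k) (T k))
      hammingNorm) :
    (0.0112 : ℝ) < accuracyThreshold (planarPhenomFailureFamily' T D') ∧
      accuracyThreshold (planarPhenomFailureFamily' T D') ≤ 1 / 4 :=
  ⟨planar_phenom_accuracyThreshold'_gt_0112 hT D' hD', planar_phenom_accuracyThreshold_le_quarter' hT1 D'⟩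

/-- **`.0112 < p_c^{ph,MWPM} ≤ 1/4`**, noisy `H_Z` record, every space-time boundary-MWPM family, poly rounds `T_k ≥ 1`.
[cite: DennisEtAl2002, §5.1 p. 19, §5.3 eq. (threshold_iso_num), §4.6] -/
theorem planar_phenom_mwpm_accuracyThreshold_mem_0112' {T : ℕ → ℕ} (hT : IsPolyBounded T) (hT1 : ∀ k, 0 < T k)
    {ι : ∀ k, PlanarQubit k → Sym2 (Option (PlanarZCheck k))} (hι : ∀ k, IsGraphlikeVia (planarHZ k) (ι k))
    (m : ∀ k, EdgeMetric (stEndsOf (ι k) (T k)))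
    {D' : ∀ k, Decoder (Option (PlanarZCheck k × Fin (T k + 1)) → ZMod 2)
      (HistoryLoc (PlanarQubit k) (PlanarZCheck k) (T k) → ZMod 2)}
    (hD : ∀ k, IsMatchingDecoder (m k) (D' k)) :
    (0.0112 : ℝ) < accuracyThreshold (planarPhenomFailureFamily' T fun k => boundaryDecoder (D' k)) ∧
      accuracyThreshold (planarPhenomFailureFamily' T fun k => boundaryDecoder (D' k)) ≤ 1 / 4 :=
  ⟨lt_of_lt_of_le thresholdValue_47476_bounds.1
      (le_accuracyThreshold (planar_phenom_mwpm_isThresholdLowerBound'_kernelZ3SymmK12 hT hι m hD)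
        ((thresholdValue_le_half _).trans (by norm_num))),
    planar_phenom_accuracyThreshold_le_quarter' hT1 _⟩

end Summit.Ventures.QEC.Thresholds
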